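import Literature.NumberTheory.LFunctions.ExceptionalZeroOfSmallLOne
import Literature.NumberTheory.LFunctions.RHWave0
import Literature.NumberTheory.LFunctions.RHWave0DeuringHeilbronnProofs
import HarnessLib

/-!
# Zhang (2022) §5, Lemma 5.5: under Assumption (A), `L(s, χ)` has a simple real zero `ρ̃` with
# `1 − ρ̃ = O(𝓛⁻²⁰²²)` and no other zero in `σ > 1 − 2𝓛⁻¹`, `|t| < 2D`

Trunk T-ANT (NumberTheory/LFunctions). Y. Zhang, *Discrete mean estimates and the Landau–Siegel
zero*, arXiv:2211.02515v1 (2022) [Zhang2022LandauSiegel], §2 and §5 [pp. 4 and 11 of the source]: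

> We let `χ` denote a real primitive character to the modulus `D` with `D` greater than a
> sufficiently large and effectively computable number. Write (2.1) `𝓛 = log D`. …
> Assumption (A) `L(1, χ) < 𝓛⁻²⁰²²`. …
> Throughout the rest of this paper we assume that (A) holds. … The next two lemmas are weaker
> forms of the Deuring-Heillbronn [sic] Phenomenon.
> **Lemma 5.5.** The function `L(s, χ)` has a simple real zero `ρ̃` such that
> (5.15) `1 − ρ̃ = O(𝓛⁻²⁰²²)` and `L(s, χ)` has no other zeros in the region
> `σ > 1 − 2𝓛⁻¹`, `|t| < 2D`.

The manuscript states Lemma 5.5 WITHOUT PROOF OR CITATION. **Status of the source: an unrefereed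
manuscript, a claimed result under adjudication** (in-tree audit of v1:
`Literature.NumberTheory.LFunctions.Zhang2022.not_ineq824` etc.; Lemma 5.5 is upstream of the
located gap and is used only through the contours of (7.19), (8.9), Lemmas 8.2/8.4). This file
supplies the lemma from the PUBLISHED record, in two parts:

* `lemma55_exceptionalZero` (**first assertion and (5.15), PROVED unconditionally**): there are
  `D₀`, `K`, `c > 0` such that for `D ≥ D₀` and any Dirichlet character `χ ≠ χ₀` mod `D` with
  `‖L(1, χ)‖ < (log D)⁻²⁰²²` there is a real zero `ρ̃ < 1` of `L(s, χ)` which is simple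
  (`L'(ρ̃, χ) ≠ 0`), satisfies `1 − ρ̃ ≤ K(log D)⁻²⁰²²` (indeed `≤ K‖L(1, χ)‖`), lies beyond
  `1 − c/log 4D` and is the only real zero there; moreover `χ² = χ₀`. This is Hecke's theorem read
  contrapositively together with Montgomery–Vaughan's Theorems 11.3–11.4
  (`Literature.NumberTheory.LFunctions.exists_exceptionalZero_of_norm_LFunction_one_lt`,
  [cite: IwaniecConversations2006, §2 (2.9)–(2.11)], [cite: MontgomeryVaughan2007, Theorems
  11.3–11.4 (11.7), (11.10)]); the printed `O(𝓛⁻²⁰²²)` (no logarithmic loss) is (11.10).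
* `lemma55_of_deuring_heilbronn` (**the whole lemma, from the Deuring–Heilbronn phenomenon**):
  assuming the tree's named fact `Literature.NumberTheory.LFunctions.deuring_heilbronn` (rh.S33,
  Linnik 1944 / Bombieri, *Le grand crible* §6, in `RHWave0.lean`; NOT discharged in the tree at
  the time of writing), for `D ≥ D₀` every zero `s` of `L(s, χ)` with `Re s > 1 − 2/log D` and
  `|Im s| < 2D` equals `ρ̃`: with `1 − ρ̃ ≤ K𝓛⁻²⁰²²` and `log(D(2 + |t|)) ≤ 3𝓛` the repulsion
  factor is `c₂ log(c₁/((1 − ρ̃) log D(2+|t|))) ≥ c₂(2021 log 𝓛 + log(c₁/3K)) ≥ 6` once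
  `log 𝓛 ≥ (6/c₂ − log(c₁/3K))/2021`, forcing `Re s ≤ 1 − 6/(3𝓛) = 1 − 2/𝓛`. An explicit
  Deuring–Heilbronn inequality that yields the lemma with numerical constants is Benli–Goel–
  Twiss–Zaman, Proc. AMS (2025), arXiv:2410.06082, Cor. 1.1 (not formalised here).

Readings (stated, not hidden): (A) is transcribed as `‖L(1, χ)‖ < (log D)⁻²⁰²²` (for real
`χ ≠ χ₀`, `L(1, χ)` is real and positive, so this is the printed inequality); "`D` sufficiently
large" is the quantifier `∃ D₀, ∀ D ≥ D₀`; of "real primitive" only `χ ≠ χ₀` is used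
(quadraticity is a CONCLUSION of Theorem 11.3, primitivity is not needed); the exceptional zero's
uniqueness among real zeros near `1` (Page) is recorded although the manuscript does not state it.
No statement about Theorems 1–2 of the source is made or implied.
-/

noncomputable section

open Complex

namespace Literature.NumberTheory.LFunctions.Zhang2022

/-- For every real `M` there is `D₀` with `log D ≥ M` for all `D ≥ D₀`. [folklore] -/
private theorem exists_nat_le_log (M : ℝ) : ∃ D₀ : ℕ, ∀ D : ℕ, D₀ ≤ D → M ≤ Real.log D := by
  refine ⟨⌈Real.exp M⌉₊ + 1, fun D hD => ?_⟩
  have h1 : Real.exp M ≤ D := by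
    have : (⌈Real.exp M⌉₊ : ℝ) + 1 ≤ D := by exact_mod_cast hD
    linarith [Nat.le_ceil (Real.exp M)]
  have hD0 : (0 : ℝ) < D := lt_of_lt_of_le (Real.exp_pos M) h1
  rw [Real.le_log_iff_exp_le hD0]
  exact h1

/-- `log 4D ≤ 3 log D` once `log D ≥ 1` (then `D > e > 2`, `log 4 < 2 ≤ 2 log D`). [folklore] -/
private theorem log_four_mul_le {D : ℝ} (hD : 1 ≤ Real.log D) (hD0 : 0 < D) :
    Real.log (4 * D) ≤ 3 * Real.log D := by
  rw [Real.log_mul (by norm_num) hD0.ne']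
  have hlog4 : Real.log 4 < 2 := by
    rw [Real.log_lt_iff_lt_exp (by norm_num)]
    have h1 := Real.exp_one_gt_d9
    have h2 : Real.exp 2 = Real.exp 1 * Real.exp 1 := by rw [← Real.exp_add]; norm_num
    nlinarith
  linarith

/-- **Zhang 2022, Lemma 5.5 — first assertion and (5.15), unconditionally.** There are `D₀ : ℕ`
and `K, c > 0` such that for every `D ≥ D₀` and every Dirichlet character `χ ≠ χ₀` mod `D`
satisfying Assumption (A) `‖L(1, χ)‖ < (log D)⁻²⁰²²`, the function `L(s, χ)` has a real zero
`ρ̃ < 1` which is simple, satisfies `1 − ρ̃ ≤ K (log D)⁻²⁰²²` (and `1 − ρ̃ ≤ K‖L(1, χ)‖`), lies in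
`(1 − c/log 4D, 1)` and is the only real zero of `L(s, χ)` there; and `χ` is quadratic.
[cite: Zhang2022LandauSiegel, Lemma 5.5 (5.15), p. 11]
[cite: MontgomeryVaughan2007, Theorems 11.3–11.4 (11.7), (11.10)]
[cite: IwaniecConversations2006, §2 (2.9)–(2.11)] -/
theorem lemma55_exceptionalZero :
    ∃ D₀ : ℕ, ∃ K : ℝ, 0 < K ∧ ∃ c : ℝ, 0 < c ∧
      ∀ (D : ℕ) [NeZero D], D₀ ≤ D → ∀ χ : DirichletCharacter ℂ D, χ ≠ 1 →
        ‖χ.LFunction 1‖ < (Real.log D ^ 2022)⁻¹ →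
        ∃ ρ : ℝ, ρ < 1 ∧ χ.LFunction ρ = 0 ∧ deriv χ.LFunction ρ ≠ 0 ∧ χ ^ 2 = 1 ∧
          1 - ρ ≤ K * (Real.log D ^ 2022)⁻¹ ∧ 1 - ρ ≤ K * ‖χ.LFunction 1‖ ∧
          1 - c / Real.log (4 * D) < ρ ∧
          (∀ β : ℝ, 1 - c / Real.log (4 * D) < β → χ.LFunction β = 0 → β = ρ) := by
  obtain ⟨c, hc, A, hA, K, hK, H⟩ := exists_exceptionalZero_of_norm_LFunction_one_lt
  obtain ⟨D₀, hD₀⟩ := exists_nat_le_log (max 1 (9 / A))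
  refine ⟨D₀, K, hK, c, hc, fun D _ hD χ hχ hA' => ?_⟩
  have hlogD : max 1 (9 / A) ≤ Real.log D := hD₀ D hD
  have hlog1 : 1 ≤ Real.log D := le_trans (le_max_left _ _) hlogD
  have hlog9 : 9 / A ≤ Real.log D := le_trans (le_max_right _ _) hlogD
  have hD0 : (0 : ℝ) < D := by exact_mod_cast Nat.pos_of_neZero D
  have hlog4D0 : 0 < Real.log (4 * D) := by
    have : Real.log D ≤ Real.log (4 * D) := Real.log_le_log hD0 (by linarith)
    linarith
  -- `(log D)⁻²⁰²² ≤ A / (log 4D)²` for `D ≥ D₀`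
  have hthr : (Real.log D ^ 2022)⁻¹ ≤ A / Real.log (4 * D) ^ 2 := by
    rw [inv_eq_one_div, div_le_div_iff₀ (by positivity) (by positivity), one_mul]
    have h3 : Real.log (4 * D) ^ 2 ≤ (3 * Real.log D) ^ 2 :=
      pow_le_pow_left₀ hlog4D0.le (log_four_mul_le hlog1 hD0) 2
    have hpow : Real.log D ≤ Real.log D ^ 2020 := le_self_pow₀ hlog1 (by norm_num)
    have h9 : 9 ≤ A * Real.log D ^ 2020 := by
      have : 9 ≤ A * Real.log D := by rwa [div_le_iff₀' hA] at hlog9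
      nlinarith
    calc Real.log (4 * D) ^ 2 ≤ 9 * Real.log D ^ 2 := by nlinarith
      _ ≤ A * Real.log D ^ 2020 * Real.log D ^ 2 := by gcongr
      _ = A * Real.log D ^ 2022 := by ring
  obtain ⟨ρ, hρc, hρ1, hρ0, hder, hsq, huniq, hK1, -⟩ := H D χ hχ (lt_of_lt_of_le hA' hthr)
  refine ⟨ρ, hρ1, hρ0, hder, hsq, ?_, hK1, hρc, huniq⟩
  exact hK1.trans (mul_le_mul_of_nonneg_left hA'.le hK.le)

/-- **Zhang 2022, Lemma 5.5 in full, from the Deuring–Heilbronn phenomenon** (the tree's named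
fact `Literature.NumberTheory.LFunctions.deuring_heilbronn`, rh.S33 — Linnik; undischarged at the
time of writing, taken here as a hypothesis): there are `D₀ : ℕ` and `K > 0` such that for every
`D ≥ D₀` and every Dirichlet character `χ ≠ χ₀` mod `D` with (A) `‖L(1, χ)‖ < (log D)⁻²⁰²²`,
`L(s, χ)` has a simple real zero `ρ̃ < 1` with `1 − ρ̃ ≤ K(log D)⁻²⁰²²`, and EVERY zero `s` of
`L(s, χ)` with `Re s > 1 − 2/log D`, `|Im s| < 2D` is `s = ρ̃` ("no other zeros in the region").
[cite: Zhang2022LandauSiegel, Lemma 5.5 (5.15), p. 11] [cite: Linnik1944]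
[cite: MontgomeryVaughan2007, Theorems 11.3–11.4] -/
theorem lemma55_of_deuring_heilbronn (hDH : deuring_heilbronn) :
    ∃ D₀ : ℕ, ∃ K : ℝ, 0 < K ∧
      ∀ (D : ℕ) [NeZero D], D₀ ≤ D → ∀ χ : DirichletCharacter ℂ D, χ ≠ 1 →
        ‖χ.LFunction 1‖ < (Real.log D ^ 2022)⁻¹ →
        ∃ ρ : ℝ, ρ < 1 ∧ χ.LFunction ρ = 0 ∧ deriv χ.LFunction ρ ≠ 0 ∧
          1 - ρ ≤ K * (Real.log D ^ 2022)⁻¹ ∧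
          ∀ s : ℂ, χ.LFunction s = 0 → 1 - 2 / Real.log D < s.re → |s.im| < 2 * D → s = ρ := by
  obtain ⟨D₁, K, hK, c, -, H⟩ := lemma55_exceptionalZero
  obtain ⟨c₁, c₂, hc₁, hc₂, hDH'⟩ := hDH
  -- the size of `log log D` that makes the repulsion factor at least `6`
  set M : ℝ := (6 / c₂ - Real.log (c₁ / (3 * K))) / 2021 with hMdef
  obtain ⟨D₂, hD₂⟩ := exists_nat_le_log (max 2 (Real.exp M))
  refine ⟨max D₁ D₂, K, hK, fun D _ hD χ hχ hA' => ?_⟩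
  have hD₁ : D₁ ≤ D := le_trans (le_max_left _ _) hD
  have hlogD : max 2 (Real.exp M) ≤ Real.log D := hD₂ D (le_trans (le_max_right _ _) hD)
  obtain ⟨ρ, hρ1, hρ0, hder, hsq, hKρ, -, -, -⟩ := H D hD₁ χ hχ hA'
  refine ⟨ρ, hρ1, hρ0, hder, hKρ, fun s hs hre him => ?_⟩
  -- notation and basic sizes
  set 𝓛 : ℝ := Real.log D with h𝓛def
  have h𝓛2 : 2 ≤ 𝓛 := le_trans (le_max_left _ _) hlogD
  have h𝓛0 : 0 < 𝓛 := by linarith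
  have h𝓛M : Real.exp M ≤ 𝓛 := le_trans (le_max_right _ _) hlogD
  have hlog𝓛 : M ≤ Real.log 𝓛 := by
    rw [Real.le_log_iff_exp_le h𝓛0]; exact h𝓛M
  have hD0 : (0 : ℝ) < D := by exact_mod_cast Nat.pos_of_neZero D
  have hD1 : (1 : ℝ) ≤ D := by exact_mod_cast Nat.pos_of_neZero D
  have hlog4 : Real.log 4 ≤ 𝓛 := by
    have : Real.log 4 < 2 := by
      rw [Real.log_lt_iff_lt_exp (by norm_num)]
      have h1 := Real.exp_one_gt_d9
      have h2 : Real.exp 2 = Real.exp 1 * Real.exp 1 := by rw [← Real.exp_add]; norm_num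
      nlinarith
    linarith
  have hquad : χ.IsQuadratic := MulChar.isQuadratic_iff_sq_eq_one.mpr hsq
  have h1ρ : 0 < 1 - ρ := by linarith
  -- `0 < Re s < 1`
  have hre0 : 0 < s.re := by
    have : 2 / 𝓛 ≤ 1 := by rw [div_le_one h𝓛0]; exact h𝓛2
    linarith
  have hre1 : s.re < 1 := by
    by_contra hge
    push Not at hge
    exact χ.LFunction_ne_zero_of_one_le_re (Or.inl hχ) hge hs
  -- suppose `s ≠ ρ̃` and apply Deuring–Heilbronn with the exceptional zero `ρ̃` to the zero `s`
  by_contra hne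
  have key := hDH' D χ hquad ρ hρ1 hρ0 χ s hs hre0 hre1 hne
  -- `ℓ = log(D(2 + |t|))`, `log 2 ≤ ℓ ≤ 3𝓛`
  set ℓ : ℝ := Real.log (D * (2 + |s.im|)) with hℓdef
  have harg1 : (2 : ℝ) ≤ D * (2 + |s.im|) := by nlinarith [abs_nonneg s.im]
  have hℓ0 : 0 < ℓ := Real.log_pos (by linarith)
  have hℓ3 : ℓ ≤ 3 * 𝓛 := by
    have hup : (D : ℝ) * (2 + |s.im|) ≤ 4 * D ^ 2 := by nlinarith [abs_nonneg s.im]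
    calc ℓ ≤ Real.log (4 * D ^ 2) := Real.log_le_log (by linarith) hup
      _ = Real.log 4 + 2 * 𝓛 := by
          rw [Real.log_mul (by norm_num) (by positivity), Real.log_pow]; push_cast; ring
      _ ≤ 3 * 𝓛 := by linarith
  -- `(1 − ρ̃) ℓ ≤ ε := 3K/𝓛²⁰²¹`, so the argument of the logarithm is `≥ c₁/ε = (c₁/3K)𝓛²⁰²¹`
  set ε : ℝ := 3 * K / 𝓛 ^ 2021 with hεdef
  have hε0 : 0 < ε := by positivity
  have hprod0 : 0 < (1 - ρ) * ℓ := mul_pos h1ρ hℓ0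
  have hprod : (1 - ρ) * ℓ ≤ ε := by
    calc (1 - ρ) * ℓ ≤ K * (𝓛 ^ 2022)⁻¹ * (3 * 𝓛) :=
          mul_le_mul hKρ hℓ3 hℓ0.le (by positivity)
      _ = ε := by rw [hεdef]; field_simp
  have hY : c₁ / ε ≤ c₁ / ((1 - ρ) * ℓ) := div_le_div_of_nonneg_left hc₁.le hprod0 hprod
  have hc3K : 0 < c₁ / (3 * K) := by positivity
  have hlogY0 : Real.log (c₁ / ε) = Real.log (c₁ / (3 * K)) + 2021 * Real.log 𝓛 := by
    have : c₁ / ε = c₁ / (3 * K) * 𝓛 ^ 2021 := by rw [hεdef]; field_simp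
    rw [this, Real.log_mul hc3K.ne' (by positivity), Real.log_pow]; push_cast; ring
  have hlogY6 : 6 / c₂ ≤ Real.log (c₁ / ((1 - ρ) * ℓ)) := by
    have h1 : Real.log (c₁ / ε) ≤ Real.log (c₁ / ((1 - ρ) * ℓ)) :=
      Real.log_le_log (by positivity) hY
    have h2 : 6 / c₂ ≤ Real.log (c₁ / ε) := by
      rw [hlogY0]
      have : 2021 * M = 6 / c₂ - Real.log (c₁ / (3 * K)) := by rw [hMdef]; field_simp
      nlinarith
    exact h2.trans h1
  -- hence the repulsion term is at least `2/𝓛`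
  have hrep : 2 / 𝓛 ≤ c₂ * Real.log (c₁ / ((1 - ρ) * ℓ)) / ℓ := by
    have h6 : 6 ≤ c₂ * Real.log (c₁ / ((1 - ρ) * ℓ)) := by
      have := mul_le_mul_of_nonneg_left hlogY6 hc₂.le
      rwa [mul_div_cancel₀ _ hc₂.ne'] at this
    calc 2 / 𝓛 = 6 / (3 * 𝓛) := by field_simp; ring
      _ ≤ 6 / ℓ := div_le_div_of_nonneg_left (by norm_num) hℓ0 hℓ3
      _ ≤ c₂ * Real.log (c₁ / ((1 - ρ) * ℓ)) / ℓ := div_le_div_of_nonneg_right h6 hℓ0.le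
  -- contradiction with `Re s > 1 − 2/𝓛`
  have : s.re ≤ 1 - 2 / 𝓛 := by linarith [key]
  linarith

/-- **Zhang 2022, Lemma 5.5 in full, UNCONDITIONALLY** (update 2026-08-25: the Deuring–Heilbronn
phenomenon `Literature.NumberTheory.LFunctions.deuring_heilbronn`, rh.S33, is now a theorem of the
tree — `deuring_heilbronn_holds`, from Bombieri's Théorème 14 (second assertion)
`LogFreeDensity.logFreeDensityDH` via `deuring_heilbronn_of_logFreeDensityDH_half` — so the
hypothesis of `lemma55_of_deuring_heilbronn` is discharged): there are `D₀ : ℕ` and `K > 0` such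
that for every `D ≥ D₀` and every Dirichlet character `χ ≠ χ₀` mod `D` with (A)
`‖L(1, χ)‖ < (log D)⁻²⁰²²`, `L(s, χ)` has a simple real zero `ρ̃ < 1` with
`1 − ρ̃ ≤ K(log D)⁻²⁰²²`, and every zero `s` of `L(s, χ)` with `Re s > 1 − 2/log D`, `|Im s| < 2D`
equals `ρ̃`. This is the manuscript's Lemma 5.5 as printed (stated there without proof or
citation), supplied from the published record; no statement about Theorems 1–2 of the source is
made or implied.
[cite: Zhang2022LandauSiegel, Lemma 5.5 (5.15), p. 11]
[cite: Bombieri1987GrandCrible, §6 Théorème 14] [cite: Linnik1944]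
[cite: MontgomeryVaughan2007, Theorems 11.3–11.4] -/
theorem lemma55 :
    ∃ D₀ : ℕ, ∃ K : ℝ, 0 < K ∧
      ∀ (D : ℕ) [NeZero D], D₀ ≤ D → ∀ χ : DirichletCharacter ℂ D, χ ≠ 1 →
        ‖χ.LFunction 1‖ < (Real.log D ^ 2022)⁻¹ →
        ∃ ρ : ℝ, ρ < 1 ∧ χ.LFunction ρ = 0 ∧ deriv χ.LFunction ρ ≠ 0 ∧
          1 - ρ ≤ K * (Real.log D ^ 2022)⁻¹ ∧
          ∀ s : ℂ, χ.LFunction s = 0 → 1 - 2 / Real.log D < s.re → |s.im| < 2 * D → s = ρ :=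
  lemma55_of_deuring_heilbronn deuring_heilbronn_holds

end Literature.NumberTheory.LFunctions.Zhang2022
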